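import Summits.QuantumFields.YangMills.Theorems.LuscherReductionDressedRitzLiftLeakageResidual
import Summits.QuantumFields.YangMills.Theorems.LuscherReductionDressedRitzPolyakovLiftDefs
import Summits.QuantumFields.YangMills.Theorems.FemtoTransferGapSlabGround
import HarnessLib

/-!
# Crux `DressedRitz` (stmt-QuantumFields-20205), line «polyakovlift», stub S-POS `stub_liftPosition` — support I:
# the DIRICHLET CURRENCY of the Lüscher position (o5): the one-step effective mass of a vacuum-subtracted insertion is a two-slice expectation
# of its squared increment

Support module (LEAD prover ym-lead-20205-polyakovlift g0; `--supports stmt-QuantumFields-20205`, helper, no closure claim) for the registered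
load-bearing stub `Summit.QuantumFields.YangMills.Cruxes.DressedRitz.PolyakovLift.stub_liftPosition` (skeleton r2 62fcf7b4f9c136d2), i.e. the
time-1 CORE clauses `PolyakovLift.DynamicCoreClauses` (tree `…PolyakovLiftDefs.lean`): (o5) Lüscher position and (o6) symmetrised couplings of
the lifted channel vectors `u_i = OpPlat.ins φ O_i = (O_i − ⟨O_i⟩_φ)·φ`, `O_i = flowLiftAt 0 (L²/√λ) g_i`, `φ` a raw vacuum.

THE IDENTITY (ground-state ∕ Dirichlet representation, fixed lattice, no RG).  For a physical unit top eigenvector `φ` (`K_βφ = λ₀φ`) and a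
physical insertion `O`, with `u = ins φ O`, `n = ‖u‖²`, `d = ⟨u, K_β u⟩`:

  `λ₀·n − d = ½ ∬ (O(U) − O(V))² φ(U) K_β(U,V) φ(V) dU dV`     (`dirichlet_identity`)

— the vacuum constants cancel exactly (`λ₀(‖Oφ‖² − c²) − (⟨Oφ,K_β(Oφ)⟩ − λ₀c²)`, tree `LiftLeak.ins_normSq ∕ ins_form`), and
`λ₀‖Oφ‖² − ⟨Oφ, K_β(Oφ)⟩` is half the two-slice expectation of the squared INCREMENT of `O` under the positive two-slice vacuum weight
`φ ⊗ K_β φ` (expand the square; `K_βφ = λ₀φ` on the two pure terms, symmetry of `K_β` on physical functions).  In path-integral words: the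
effective energy `1 − d/(nλ₀)` of the channel `u` is `⟨(O(τ+a) − O(τ))²⟩ / (2 Var O)` in the vacuum of the infinite Euclidean time direction —
the QUADRATIC VARIATION RATE of the flowed observable.  This is the currency in which a renormalisation-group ∕ Born–Oppenheimer proof of (o5)
is naturally written (slow variable ⇒ small one-step increment; the UV roughness of single links, `δU = O(β^{-1/2})` per step, enters `O` only
through the flow at `t = L²/√λ`, at relative order `g₀³/√L` — cf. the standing disprover's (N), `Cruxes/DressedRitz/Disproof.lean`).

THE PRESS-BUTTON.  (o5) for `u` is EQUIVALENT to the two-sided DIRICHLET BAND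

  `λ₀ n (1 − e^{Cλ²/L} μ_{i+1}/μ₀) ≤ D ≤ λ₀ n (1 − e^{−Cλ²/L} μ_{i+1}/μ₀)`,   `D := λ₀ n − d`,

i.e. the Dirichlet energy per unit norm is the ONE-SITE energy `1 − (μ_{i+1}/μ₀)(B)` (`≈ Δ_{i+1}·λ/L`) to relative `O(λ)` (`position_of_dirichletBand`,
`dirichletBand_of_position`; pure real algebra, `μ₀ > 0`).  In the ONE-SITE model the same identity with `φ = e₀`, `O = e_j/e₀` gives
`D = μ₀ − μ_j` EXACTLY (eigen-ratio insertions are exact eigenvectors), so (o5) reads: «the quadratic-variation matrix of the flowed Polyakov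
eigen-ratios under the fine two-slice vacuum law is `λ₀/μ₀(B) ×` the one-site one at `B = 2L³/λ³`, to relative `O(λ)` on the diagonal» —
universality of the zero mode's quadratic variation (Lüscher 1983 §3; for flowed observables in a periodic femto box cf. Fodor–Holland–Kuti–
Nógrádi–Wong 2012, §§2–3: zero modes exact with the quartic measure, non-zero modes Gaussian at one loop, flow leaves the zero mode constant at
leading order).

* `inner_increment_sq` — the `V`-integral of the squared increment against `φ(U)K_β(U,V)φ(V)` (linearity; tree `integrable_transferKernel_mul`);
* `increment_sq_eq` — `½∬(ΔO)² φK_βφ = λ₀‖Oφ‖² − ⟨Oφ, K_β(Oφ)⟩`;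
* ★ `dirichlet_identity` — `λ₀‖u‖² − ⟨u,K_βu⟩ = ½∬(ΔO)² φK_βφ` for `u = ins φ O`;
* `position_of_dirichletBand` ∕ `dirichletBand_of_position` — (o5) ⟺ the Dirichlet band (VERBATIM (o5) conjunct texts of `DynamicCoreClauses`).

HONEST FRAMING: fixed-lattice bookkeeping on the conditional femto rung R2b1; the stub `stub_liftPosition` (the XL renormalisation-group estimate)
stays OPEN; nothing here bears on infinite volume, the continuum limit or the Clay gap.  References: M. Lüscher, NPB 219 (1983) 233
[cite: Luscher1983, §3]; M. Lüscher, U. Wolff, NPB 339 (1990) 222 [cite: LuscherWolff1990]; E. Seiler, LNP 159 [cite: SeilerLNP1982, §3].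
-/

set_option autoImplicit false

noncomputable section

open MeasureTheory Filter Topology Real
open Literature.MathematicalPhysics.QuantumFieldTheory
open Literature.MathematicalPhysics.QuantumLattice
open scoped BigOperators

namespace Summit.QuantumFields.YangMills.Theorems.FemtoTransferGap.LiftPos

open Summit.QuantumFields.YangMills.Theorems.FemtoTransferGap
open Summit.QuantumFields.YangMills.Theorems.FemtoTransferGap.OpPlat

section Femto

variable {L : ℕ} [NeZero L]

/-! ## §1 The two-slice expectation of the squared increment -/

/-- The inner (`V`-) integral of the squared increment against the two-slice weight: for fixed `U`,
`∫ (O U − O V)² φ(U)K_β(U,V)φ(V) dV = (O²φ)(U)·(K_βφ)(U) − 2(Oφ)(U)·(K_β(Oφ))(U) + φ(U)·(K_β(O²φ))(U)`. [folklore] -/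
theorem inner_increment_sq (β : ℝ) {φ O : GaugeConfig 3 L SU2 → ℝ} (hφ : IsPhys φ) (hO : IsPhys O) (U : GaugeConfig 3 L SU2) :
    ∫ V, (O U - O V) ^ 2 * (φ U * transferKernel su2Rep β U V * φ V) ∂(configMeasure SU2 L) =
      ((O * O * φ) * transferApply β φ) U - 2 * ((O * φ) * transferApply β (O * φ)) U
        + (φ * transferApply β (O * O * φ)) U := by
  have hOφ : IsPhys (O * φ) := isPhys_mul hO hφ
  have hOOφ : IsPhys (O * O * φ) := isPhys_mul (isPhys_mul hO hO) hφ
  obtain ⟨C₁, hC₁⟩ := hφ.bounded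
  obtain ⟨C₂, hC₂⟩ := hOφ.bounded
  obtain ⟨C₃, hC₃⟩ := hOOφ.bounded
  have i₁ := integrable_transferKernel_mul β U hφ.measurable hC₁
  have i₂ := integrable_transferKernel_mul β U hOφ.measurable hC₂
  have i₃ := integrable_transferKernel_mul β U hOOφ.measurable hC₃
  have hpt : ∀ V, (O U - O V) ^ 2 * (φ U * transferKernel su2Rep β U V * φ V) =
      (O U * O U * φ U) * (transferKernel su2Rep β U V * φ V) - 2 * (O U * φ U) * (transferKernel su2Rep β U V * (O * φ) V)
        + φ U * (transferKernel su2Rep β U V * (O * O * φ) V) := fun V => by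
    simp only [Pi.mul_apply]; ring
  simp_rw [hpt]
  have iA : Integrable (fun V => O U * O U * φ U * (transferKernel su2Rep β U V * φ V)) (configMeasure SU2 L) := i₁.const_mul _
  have iB : Integrable (fun V => 2 * (O U * φ U) * (transferKernel su2Rep β U V * (O * φ) V)) (configMeasure SU2 L) :=
    i₂.const_mul _
  have iC : Integrable (fun V => φ U * (transferKernel su2Rep β U V * (O * O * φ) V)) (configMeasure SU2 L) := i₃.const_mul _
  have iAB : Integrable (fun V => O U * O U * φ U * (transferKernel su2Rep β U V * φ V)
      - 2 * (O U * φ U) * (transferKernel su2Rep β U V * (O * φ) V)) (configMeasure SU2 L) := iA.sub iB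
  rw [integral_add iAB iC, integral_sub iA iB, integral_const_mul, integral_const_mul, integral_const_mul]
  simp only [Pi.mul_apply, transferApply_apply]
  ring

/-- **`½∬(O(U) − O(V))² φ(U)K_β(U,V)φ(V) = λ₀‖Oφ‖² − ⟨Oφ, K_β(Oφ)⟩`** for a physical top eigenvector `φ` (`K_βφ = λ₀φ`) and a physical
insertion `O` (expand the square; the two pure terms are `λ₀∫O²φ²` by the eigen-equation and the symmetry of `K_β`). [cite: SeilerLNP1982, §3] -/
theorem increment_sq_eq (β : ℝ) {φ O : GaugeConfig 3 L SU2 → ℝ} (hφ : IsPhys φ) (hO : IsPhys O)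
    (heig : transferApply β φ = levelValue su2Rep L β 0 • φ) :
    (1 / 2 : ℝ) * ∫ U, ∫ V, (O U - O V) ^ 2 * (φ U * transferKernel su2Rep β U V * φ V) ∂(configMeasure SU2 L) ∂(configMeasure SU2 L) =
      levelValue su2Rep L β 0 * l2 (O * φ) (O * φ) - l2 (O * φ) (transferApply β (O * φ)) := by
  have hOφ : IsPhys (O * φ) := isPhys_mul hO hφ
  have hOOφ : IsPhys (O * O * φ) := isPhys_mul (isPhys_mul hO hO) hφ
  simp_rw [inner_increment_sq β hφ hO]
  have j₁ : Integrable (fun U => ((O * O * φ) * transferApply β φ) U) (configMeasure SU2 L) :=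
    (isPhys_mul hOOφ (isPhys_transferApply β hφ)).integrable
  have j₂ : Integrable (fun U => ((O * φ) * transferApply β (O * φ)) U) (configMeasure SU2 L) :=
    (isPhys_mul hOφ (isPhys_transferApply β hOφ)).integrable
  have j₃ : Integrable (fun U => (φ * transferApply β (O * O * φ)) U) (configMeasure SU2 L) :=
    (isPhys_mul hφ (isPhys_transferApply β hOOφ)).integrable
  have j₂' : Integrable (fun U => 2 * ((O * φ) * transferApply β (O * φ)) U) (configMeasure SU2 L) := j₂.const_mul _
  have j12 : Integrable (fun U => ((O * O * φ) * transferApply β φ) U - 2 * ((O * φ) * transferApply β (O * φ)) U)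
      (configMeasure SU2 L) := j₁.sub j₂'
  rw [integral_add j12 j₃, integral_sub j₁ j₂', integral_const_mul]
  -- the three `U`-integrals are `l2` pairings
  have e₁ : ∫ U, ((O * O * φ) * transferApply β φ) U ∂(configMeasure SU2 L) = levelValue su2Rep L β 0 * l2 (O * φ) (O * φ) := by
    rw [heig]
    have : (fun U => ((O * O * φ) * (levelValue su2Rep L β 0 • φ)) U) =
        fun U => levelValue su2Rep L β 0 * ((O * φ) U * (O * φ) U) := by
      funext U; simp only [Pi.mul_apply, Pi.smul_apply, smul_eq_mul]; ring
    rw [this, integral_const_mul]; rfl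
  have e₂ : ∫ U, ((O * φ) * transferApply β (O * φ)) U ∂(configMeasure SU2 L) = l2 (O * φ) (transferApply β (O * φ)) := rfl
  have e₃ : ∫ U, (φ * transferApply β (O * O * φ)) U ∂(configMeasure SU2 L) = levelValue su2Rep L β 0 * l2 (O * φ) (O * φ) := by
    have h1 : ∫ U, (φ * transferApply β (O * O * φ)) U ∂(configMeasure SU2 L) = l2 φ (transferApply β (O * O * φ)) := rfl
    rw [h1, ← l2_transferApply_comm β hφ hOOφ, heig]
    have : (fun U => (levelValue su2Rep L β 0 • φ) U * (O * O * φ) U) =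
        fun U => levelValue su2Rep L β 0 * ((O * φ) U * (O * φ) U) := by
      funext U; simp only [Pi.mul_apply, Pi.smul_apply, smul_eq_mul]; ring
    unfold l2; rw [this, integral_const_mul]
  rw [e₁, e₂, e₃]; ring

/-! ## §2 ★ The Dirichlet identity for vacuum-subtracted insertions -/

/-- ★ **DIRICHLET IDENTITY**: for a raw vacuum `φ` (physical, `‖φ‖ = 1`, `K_βφ = λ₀φ`) and a physical insertion `O`, the channel vector
`u = ins φ O = (O − ⟨O⟩_φ)φ` has `λ₀‖u‖² − ⟨u, K_βu⟩ = ½∬(O(U) − O(V))² φ(U)K_β(U,V)φ(V)` — its one-step effective-mass deficit is the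
two-slice vacuum expectation of half the squared increment of `O` (the vacuum constants cancel). [cite: LuscherWolff1990] [cite: SeilerLNP1982, §3] -/
theorem dirichlet_identity (β : ℝ) {φ O : GaugeConfig 3 L SU2 → ℝ} (hφ : IsPhys φ) (hO : IsPhys O) (hφ1 : l2 φ φ = 1)
    (heig : transferApply β φ = levelValue su2Rep L β 0 • φ) :
    levelValue su2Rep L β 0 * l2 (ins φ O) (ins φ O) - l2 (ins φ O) (transferApply β (ins φ O)) =
      (1 / 2 : ℝ) * ∫ U, ∫ V, (O U - O V) ^ 2 * (φ U * transferKernel su2Rep β U V * φ V)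
        ∂(configMeasure SU2 L) ∂(configMeasure SU2 L) := by
  rw [increment_sq_eq β hφ hO heig, LiftLeak.ins_normSq hφ hO hφ1, LiftLeak.ins_form β hφ hO hφ1 heig]
  ring

/-- The two-slice expectation of the squared increment is non-negative (so `⟨u,K_βu⟩ ≤ λ₀‖u‖²` is visible pointwise). [folklore] -/
theorem increment_sq_nonneg (β : ℝ) {φ : GaugeConfig 3 L SU2 → ℝ} (hφpos : ∀ U, 0 ≤ φ U) (O : GaugeConfig 3 L SU2 → ℝ) :
    0 ≤ ∫ U, ∫ V, (O U - O V) ^ 2 * (φ U * transferKernel su2Rep β U V * φ V) ∂(configMeasure SU2 L) ∂(configMeasure SU2 L) :=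
  integral_nonneg fun U => integral_nonneg fun V =>
    mul_nonneg (sq_nonneg _) (mul_nonneg (mul_nonneg (hφpos U) (transferKernel_pos su2Rep β U V).le) (hφpos V))

/-! ## §3 The press-button: the Lüscher position (o5) ⟺ a two-sided Dirichlet band (pure real algebra) -/

/-- **(o5) from the Dirichlet band.**  With `μ₀ > 0`, `D = λ₀ n − d`: if `λ₀n(1 − e^{δ}μ_{i+1}/μ₀) ≤ D ≤ λ₀n(1 − e^{−δ}μ_{i+1}/μ₀)` then
`d μ₀ ≤ e^{δ}(μ_{i+1}λ₀) n` and `(μ_{i+1}λ₀) n ≤ e^{δ} d μ₀` (the two (o5) conjuncts, `e^{δ} = exp (C λ²/L)`). [folklore] -/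
theorem position_of_dirichletBand {d n m0 m1 l0 E : ℝ} (hm0 : 0 < m0) (hE : 0 < E)
    (hlo : l0 * n * (1 - E * m1 / m0) ≤ l0 * n - d) (hhi : l0 * n - d ≤ l0 * n * (1 - E⁻¹ * m1 / m0)) :
    d * m0 ≤ E * (m1 * l0) * n ∧ m1 * l0 * n ≤ E * (d * m0) := by
  constructor
  · -- from `hlo`: d ≤ l0 n E m1 / m0
    have h1 : d ≤ l0 * n * (E * m1 / m0) := by linarith
    have h2 : l0 * n * (E * m1 / m0) * m0 = E * (m1 * l0) * n := by field_simp
    calc d * m0 ≤ l0 * n * (E * m1 / m0) * m0 := mul_le_mul_of_nonneg_right h1 hm0.le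
      _ = E * (m1 * l0) * n := h2
  · -- from `hhi`: l0 n E⁻¹ m1/m0 ≤ d
    have h1 : l0 * n * (E⁻¹ * m1 / m0) ≤ d := by linarith
    have h2 : l0 * n * (E⁻¹ * m1 / m0) * (E * m0) = m1 * l0 * n := by field_simp
    calc m1 * l0 * n = l0 * n * (E⁻¹ * m1 / m0) * (E * m0) := h2.symm
      _ ≤ d * (E * m0) := mul_le_mul_of_nonneg_right h1 (mul_pos hE hm0).le
      _ = E * (d * m0) := by ring

/-- **The Dirichlet band from (o5)** (converse). [folklore] -/
theorem dirichletBand_of_position {d n m0 m1 l0 E : ℝ} (hm0 : 0 < m0) (hE : 0 < E)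
    (hA : d * m0 ≤ E * (m1 * l0) * n) (hB : m1 * l0 * n ≤ E * (d * m0)) :
    l0 * n * (1 - E * m1 / m0) ≤ l0 * n - d ∧ l0 * n - d ≤ l0 * n * (1 - E⁻¹ * m1 / m0) := by
  have hEm0 : 0 < E * m0 := mul_pos hE hm0
  constructor
  · have h2 : l0 * n * (E * m1 / m0) = E * (m1 * l0) * n / m0 := by ring
    have h1 : d ≤ l0 * n * (E * m1 / m0) := by
      rw [h2, le_div_iff₀ hm0]; exact hA
    linarith
  · have h2 : l0 * n * (E⁻¹ * m1 / m0) = m1 * l0 * n / (E * m0) := by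
      field_simp
    have h1 : l0 * n * (E⁻¹ * m1 / m0) ≤ d := by
      rw [h2, div_le_iff₀ hEm0]
      calc m1 * l0 * n ≤ E * (d * m0) := hB
        _ = d * (E * m0) := by ring
    linarith

/-- ★ **The (o5) conjunct of `PolyakovLift.DynamicCoreClauses k C β u`, VERBATIM, from Dirichlet bands** — for any family `u` (in the line:
`u = liftFamily β φ g`, `D_i = ½∬(Δ(g_i∘Π_t))² φK_βφ` by `dirichlet_identity`): if every `D_i := λ₀‖u_i‖² − ⟨u_i,K_βu_i⟩` lies in the band
`[λ₀‖u_i‖²(1 − e^{Cλ²/L}μ_{i+1}/μ₀), λ₀‖u_i‖²(1 − e^{−Cλ²/L}μ_{i+1}/μ₀)]` (`μ₀ = μ₀(B) > 0`), then (o5) holds. [cite: Luscher1983, §3] -/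
theorem coreO5_of_dirichletBands {k : ℕ} (C β : ℝ) {u : Fin k → (GaugeConfig 3 L SU2 → ℝ)}
    (hμ0 : 0 < levelValue su2Rep 1 (oneSiteCoupling β L) 0)
    (hband : ∀ i : Fin k,
      levelValue su2Rep L β 0 * l2 (u i) (u i) *
          (1 - Real.exp (C * luscherLambda β L ^ 2 / L) * levelValue su2Rep 1 (oneSiteCoupling β L) ((i : ℕ) + 1) /
            levelValue su2Rep 1 (oneSiteCoupling β L) 0) ≤
        levelValue su2Rep L β 0 * l2 (u i) (u i) - l2 (u i) (transferApply β (u i)) ∧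
      levelValue su2Rep L β 0 * l2 (u i) (u i) - l2 (u i) (transferApply β (u i)) ≤
        levelValue su2Rep L β 0 * l2 (u i) (u i) *
          (1 - (Real.exp (C * luscherLambda β L ^ 2 / L))⁻¹ * levelValue su2Rep 1 (oneSiteCoupling β L) ((i : ℕ) + 1) /
            levelValue su2Rep 1 (oneSiteCoupling β L) 0)) :
    ∀ i : Fin k,
      l2 (u i) (transferApply β (u i)) * levelValue su2Rep 1 (oneSiteCoupling β L) 0 ≤
          Real.exp (C * luscherLambda β L ^ 2 / L) *
            (levelValue su2Rep 1 (oneSiteCoupling β L) ((i : ℕ) + 1) * levelValue su2Rep L β 0) * l2 (u i) (u i) ∧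
      levelValue su2Rep 1 (oneSiteCoupling β L) ((i : ℕ) + 1) * levelValue su2Rep L β 0 * l2 (u i) (u i) ≤
          Real.exp (C * luscherLambda β L ^ 2 / L) *
            (l2 (u i) (transferApply β (u i)) * levelValue su2Rep 1 (oneSiteCoupling β L) 0) :=
  fun i => position_of_dirichletBand hμ0 (Real.exp_pos _) (hband i).1 (hband i).2

end Femto

end Summit.QuantumFields.YangMills.Theorems.FemtoTransferGap.LiftPos

end
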